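import Summits.CriticalPhenomena.PercolationContinuityZ3.Theorems.PercNearOneGluingNoHeavyLowerTailMajorityGluingTypeTableCertificates
import Summits.CriticalPhenomena.PercolationContinuityZ3.Theorems.PercNearOneGluingNoHeavyLowerTailMajorityGluingTypeTableBottomFacts
import Summits.CriticalPhenomena.PercolationContinuityZ3.Theorems.PercNearOneGluingNoHeavyLowerTailMajorityGluingConvexBootstrapRpowCert
import HarnessLib

/-!
# THEOREM BOTTOM of the abstract `(4,3)` programme at the level of laws — regimes A/B2 and the helpers of regime B1
(lane prim-rate, constants-miner 1, gen 27; CLEAN-CERTIFICATES.md §5 (PROPOSITION W₄) and §8 (THEOREM BOTTOM))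

Support file for the closed crux `NoHeavyLowerTail` (stmt-CriticalPhenomena-4575), majority-gluing line.  THEOREM BOTTOM
(mine-1 gen 24, BENCH l.222) bounds the excess `E = E f/δ₁ − 1` of every law of the abstract programme by `O(M^{1.686})`;
its proof is LEMMA B + LEMMA J + the STAR certificates + ISO₃/ISO₄ + the set facts (S2)–(S5), by regimes in
`K = x(KK)` versus the dominant layer.  For LAWS `x : DType → ℝ` (`x ≥ 0`) with the rows as hypotheses (linear rows
`lin feat x ≤ 0`, the normalisation `x(v₁ cut) ≤ 1`, ISO₃ rows as `rpow` inequalities `u_S^{c₃} ≤ M^{3−c₃}·Πρ`) this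
file proves: the law-level LEMMA B / LEMMA J inputs (`ctrl_le`, `E_le_T_all`, `rho0_le_one`, `piSupp_le`,
`K_le_hubTriples`, `cut_le_one`, `rho1234_eq`); the real-analysis core (`iso3_bootstrap`:
`K ≤ C(AK²)^{1/c} ⟹ K ≤ (C^c A)^{1/(c−2)}`, `rpow_b3_root`: `(M^{3−c₃})^{1/(c₃−2)} = M^{√3}`, `iso4_solve`:
`(Tt)^c ≤ A·T·t³ ⟹ T ≤ A^{1/(2c−4)}`, `c4_bounds`); **regimes A and B2** (`T_z ≤ 2K` ∀z):
`E ≤ 2(6^{c₃}·25)^{1/(c₃−2)}·M^{√3}` (`= 1.41·10⁹·M^{√3}`) and PROPOSITION W₄ (`T_z ≤ K`: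
`E ≤ K ≤ (6^{c₃}·9)^{1/(c₃−2)}·M^{√3} = 4.34·10⁷·M^{√3}`).  Regime B1 (one file per dominant relay) and the assembled
theorem follow in `…TypeTableBottomB1W{1,2,3,4}` / `…TypeTableBottom`.  No definitions, no sorries (`Km`, `Pim`,
`Rho0` are abbreviations of `…TypeTableClasses`).  [cite: VandenbergHaggstromKahn2005, Thm. 1.3 (p. 6)]
-/

namespace Summit.CriticalPhenomena.PercolationContinuityZ3.Theorems

namespace HubOnly
namespace TypeTable

noncomputable section
open DType

/-! ### Monotonicity of `lin` and small real-analysis helpers -/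

/-- `lin` is monotone in the functional under a nonnegative law. -/
theorem lin_mono {φ ψ : DType → ℤ} {x : DType → ℝ} (h : ∀ τ ∈ allTypes, φ τ ≤ ψ τ) (hx : ∀ τ, 0 ≤ x τ) :
    lin φ x ≤ lin ψ x := by
  have hc : ∀ τ ∈ allTypes, combo [(1, φ), (-1, ψ)] τ ≤ 0 := fun τ hτ => by
    simp only [combo, List.map_cons, List.map_nil, List.sum_cons, List.sum_nil]; linarith [h τ hτ]
  have := cc_bound _ x hc hx
  simp only [List.map_cons, List.map_nil, List.sum_cons, List.sum_nil] at this
  push_cast at this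
  linarith

/-- `x(A ∩ B) ≤ x(A)`. -/
theorem lin_ind_and_le (A B : DType → Bool) {x : DType → ℝ} (hx : ∀ τ, 0 ≤ x τ) :
    lin (fun τ => ind (A τ && B τ)) x ≤ lin (fun τ => ind (A τ)) x :=
  lin_mono (fun τ _ => by unfold ind; cases A τ <;> cases B τ <;> simp) hx

/-- `B₁ ≡ 0`: the budget row of relay 1 against itself is void. -/
theorem lin_bud_one (x : DType → ℝ) : lin (fun τ => τ.bud 1) x = 0 :=
  lin_eq_zero fun τ _ => by simp [DType.bud]

/-- `lin` respects typewise equality of functionals on the table. -/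
theorem lin_congr {φ ψ : DType → ℤ} (h : ∀ τ ∈ allTypes, φ τ = ψ τ) (x : DType → ℝ) : lin φ x = lin ψ x := by
  unfold lin; exact congrArg List.sum (List.map_congr_left fun τ hτ => by simp only [h τ hτ])

/-- **The ISO₃ bootstrap (pure real arithmetic).**  `0 ≤ K`, `0 < A`, `2 < c`, `0 < C` and `K ≤ C·(A·K²)^{1/c}`
imply `K ≤ (C^c·A)^{1/(c−2)}` (PROPOSITION W₄'s amplification exponent `c/(c−2)`). -/
theorem iso3_bootstrap {K A c C : ℝ} (hK : 0 ≤ K) (hA : 0 < A) (hc : 2 < c) (hC : 0 < C)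
    (h : K ≤ C * (A * K ^ 2) ^ c⁻¹) : K ≤ (C ^ c * A) ^ (c - 2)⁻¹ := by
  rcases hK.eq_or_lt with hK0 | hKpos
  · rw [← hK0]; exact Real.rpow_nonneg (by positivity) _
  have hc0 : 0 < c := by linarith
  have hAK : 0 ≤ A * K ^ 2 := by positivity
  have h1 : K ^ c ≤ C ^ c * (A * K ^ 2) := by
    have := Real.rpow_le_rpow hK h hc0.le
    rwa [Real.mul_rpow hC.le (Real.rpow_nonneg hAK _), Real.rpow_inv_rpow hAK (ne_of_gt hc0)] at this
  have h2 : K ^ c = K ^ (c - 2) * K ^ 2 := by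
    rw [← Real.rpow_two, ← Real.rpow_add hKpos]; ring_nf
  have h3 : K ^ (c - 2) ≤ C ^ c * A := by
    rw [h2] at h1
    have hK2 : 0 < K ^ 2 := by positivity
    by_contra hcon
    push Not at hcon
    nlinarith [mul_lt_mul_of_pos_right hcon hK2]
  calc K = (K ^ (c - 2)) ^ (c - 2)⁻¹ := (Real.rpow_rpow_inv hKpos.le (by linarith)).symm
    _ ≤ (C ^ c * A) ^ (c - 2)⁻¹ := Real.rpow_le_rpow (Real.rpow_nonneg hKpos.le _) h3 (by
        rw [inv_nonneg]; linarith)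

/-- The three-point exponent identity `(3 − c₃)/(c₃ − 2) = √3` (`c₃ = (3+√3)/2`), in the form
`(M^{3−c₃})^{1/(c₃−2)} = M^{√3}`. -/
theorem rpow_b3_root (M : ℝ) (hM : 0 ≤ M) :
    (M ^ (3 - (3 + Real.sqrt 3) / 2)) ^ ((3 + Real.sqrt 3) / 2 - 2)⁻¹ = M ^ Real.sqrt 3 := by
  have h3 : Real.sqrt 3 * Real.sqrt 3 = 3 := Real.mul_self_sqrt (by norm_num)
  have h1 : (1:ℝ) < Real.sqrt 3 := by
    rw [show (1:ℝ) = Real.sqrt 1 by simp]; exact Real.sqrt_lt_sqrt (by norm_num) (by norm_num)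
  have hne : (3 + Real.sqrt 3) / 2 - 2 ≠ 0 := by intro h; nlinarith
  rw [← Real.rpow_mul hM]
  congr 1
  rw [← div_eq_mul_inv, div_eq_iff hne]
  linear_combination (-1 / 2 : ℝ) * h3

/-- Product bound with bounded supports: `m ≥ 0`, `0 ≤ r ≤ R`, `0 ≤ p, q ≤ P` give `m·r·p·q ≤ (R·P²)·m`. -/
theorem prod_bound' {m r p q R P : ℝ} (hm : 0 ≤ m) (hr : 0 ≤ r) (hrR : r ≤ R) (hp : 0 ≤ p) (hpP : p ≤ P)
    (hq : 0 ≤ q) (hqP : q ≤ P) : m * r * p * q ≤ (R * P ^ 2) * m := by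
  have h1 : p * q ≤ P * P := mul_le_mul hpP hqP hq (hp.trans hpP)
  have h2 : m * r ≤ m * R := mul_le_mul_of_nonneg_left hrR hm
  calc m * r * p * q = (m * r) * (p * q) := by ring
    _ ≤ (m * R) * (P * P) := mul_le_mul h2 h1 (mul_nonneg hp hq) (mul_nonneg hm (hr.trans hrR))
    _ = (R * P ^ 2) * m := by ring

/-- The case `R = 1` (hub triples: `ρ₀ ≤ 1`): `m·r·p·q ≤ P²·m`. -/
theorem prod_bound {m r p q P : ℝ} (hm : 0 ≤ m) (hr : 0 ≤ r) (hr1 : r ≤ 1) (hp : 0 ≤ p) (hpP : p ≤ P)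
    (hq : 0 ≤ q) (hqP : q ≤ P) : m * r * p * q ≤ P ^ 2 * m := by
  simpa using prod_bound' hm hr hr1 hp hpP hq hqP

/-! ### Regimes A and B2 of THEOREM BOTTOM (PROPOSITION W₄; CLEAN-CERTIFICATES §5, §8) -/

/-- LEMMA B with the control sets, law level: `x(CTRL_z) ≤ T_z − E` for every relay `z` under the budgets. -/
theorem ctrl_le (x : DType → ℝ) (hB2 : lin (fun τ => τ.bud 2) x ≤ 0)
    (hB3 : lin (fun τ => τ.bud 3) x ≤ 0) (hB4 : lin (fun τ => τ.bud 4) x ≤ 0) :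
    ∀ z ∈ [1, 2, 3, 4], lin (fun τ => ind (τ.ctrl z)) x ≤ Tm z x - E x := by
  have h1 := cc_eq _ x (fun τ hτ => (ctrl_combo τ hτ).2)
  have h2 := fun w hw => cc_eq _ x (fun τ hτ => (ctrl_combo τ hτ).1 w hw)
  have h22 := h2 2 (by simp); have h23 := h2 3 (by simp); have h24 := h2 4 (by simp)
  simp only [List.map_cons, List.map_nil, List.sum_cons, List.sum_nil] at h1 h22 h23 h24
  push_cast at h1 h22 h23 h24
  simp only [E, Tm]
  intro z hz
  simp only [List.mem_cons, List.not_mem_nil, or_false] at hz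
  rcases hz with rfl | rfl | rfl | rfl <;> linarith

/-- `E ≤ T_z` for every relay (LEMMA B (i): `E ≤ T_min`) under the budgets. -/
theorem E_le_T_all (x : DType → ℝ) (hx : ∀ τ, 0 ≤ x τ) (hB2 : lin (fun τ => τ.bud 2) x ≤ 0)
    (hB3 : lin (fun τ => τ.bud 3) x ≤ 0) (hB4 : lin (fun τ => τ.bud 4) x ≤ 0) :
    ∀ z ∈ [1, 2, 3, 4], E x ≤ Tm z x := by
  intro z hz
  have h := ctrl_le x hB2 hB3 hB4 z hz
  have h0 := lin_ind_nonneg (fun τ => τ.ctrl z) hx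
  linarith

/-- The hub support is a budget event: `ρ₀^{0ab}(x) ≤ x(v_a cut) ≤ x(v₁ cut) ≤ 1` in scale-free units. -/
theorem rho0_le_one (x : DType → ℝ) (hx : ∀ τ, 0 ≤ x τ) (hnorm : lin (fun τ => τ.cutZ 1) x ≤ 1)
    (hB2 : lin (fun τ => τ.bud 2) x ≤ 0) (hB3 : lin (fun τ => τ.bud 3) x ≤ 0)
    (hB4 : lin (fun τ => τ.bud 4) x ≤ 0) :
    ∀ a ∈ [1, 2, 3, 4], ∀ b ∈ [1, 2, 3, 4], a ≠ b → Rho0 a b x ≤ 1 := by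
  intro a ha b hb hab
  have h := fun τ hτ => budget_combo τ hτ a ha b hb hab
  have h1 := cc_bound _ x (fun τ hτ => (h τ hτ).1) hx
  have h3 := cc_bound _ x (fun τ hτ => (h τ hτ).2.2) hx
  simp only [List.map_cons, List.map_nil, List.sum_cons, List.sum_nil] at h1 h3
  push_cast at h1 h3
  have hBa : lin (fun τ => τ.bud a) x ≤ 0 := by
    simp only [List.mem_cons, List.not_mem_nil, or_false] at ha
    rcases ha with rfl | rfl | rfl | rfl
    · rw [lin_bud_one]
    · exact hB2
    · exact hB3
    · exact hB4
  simp only [Rho0]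
  linarith

/-- The support bound of LEMMA J: `π_{z¬y}(x) ≤ (T_z − E) + T_y + K` under the budgets. -/
theorem piSupp_le (x : DType → ℝ) (hx : ∀ τ, 0 ≤ x τ) (hB2 : lin (fun τ => τ.bud 2) x ≤ 0)
    (hB3 : lin (fun τ => τ.bud 3) x ≤ 0) (hB4 : lin (fun τ => τ.bud 4) x ≤ 0) :
    ∀ z ∈ [1, 2, 3, 4], ∀ y ∈ [1, 2, 3, 4], z ≠ y → Pim z y x ≤ (Tm z x - E x) + Tm y x + Km x := by
  intro z hz y hy hzy
  have h := fun τ hτ => piSupp_combo τ hτ z hz y hy hzy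
  have h1 := cc_bound _ x (fun τ hτ => (h τ hτ).1) hx
  have h2 := cc_bound _ x (fun τ hτ => (h τ hτ).2) hx
  simp only [List.map_cons, List.map_nil, List.sum_cons, List.sum_nil] at h1 h2
  push_cast at h1 h2
  have h3 := lin_ind_and_le (fun τ => τ.isKK) (fun τ => τ.piSupp z y) hx
  have h4 := ctrl_le x hB2 hB3 hB4 z hz
  simp only [Pim, Km, Tm] at *
  linarith

/-- `K ≤ Σ_{a<b} u_{0ab}(x)` ((J2): every `KK` type lies in a hub triple). -/
theorem K_le_hubTriples (x : DType → ℝ) (hx : ∀ τ, 0 ≤ x τ) :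
    Km x ≤ uS [0, 1, 2] x + uS [0, 1, 3] x + uS [0, 1, 4] x + uS [0, 2, 3] x + uS [0, 2, 4] x + uS [0, 3, 4] x := by
  have h := cc_bound _ x KK_le_hubTriples_combo hx
  simp only [List.map_cons, List.map_nil, List.sum_cons, List.sum_nil] at h
  push_cast at h
  simp only [Km, uS]
  linarith

/-- The ISO₄ support of a relay is its profile: `ρ_z^{1234}(x) = S_z(x) + T_z(x)` (the profile identity at law level;
turns the isolation row `u₁₂₃₄^{c₄} ≤ M^{4−c₄}·Π_z ρ_z^{1234}` into the profile form used below). -/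
theorem rho1234_eq (x : DType → ℝ) : ∀ z ∈ [1, 2, 3, 4],
    lin (fun τ => ind (τ.rho [1, 2, 3, 4] z)) x = Sm z x + Tm z x := by
  intro z hz
  have h := cc_eq [(1, fun τ => ind (τ.rho [1, 2, 3, 4] z)), (-1, fun τ => ind (τ.isS z)),
    (-1, fun τ => ind (τ.isT z))] x (fun τ hτ => by
      simp only [combo, List.map_cons, List.map_nil, List.sum_cons, List.sum_nil, profile_identity τ hτ z hz]; ring)
  simp only [List.map_cons, List.map_nil, List.sum_cons, List.sum_nil] at h
  push_cast at h
  simp only [Sm, Tm]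
  linarith

/-- One hub-triple row under the regime bound: if `ρ₀ ≤ 1` and both relay supports are `≤ P` (`P ≥ 0`), the scale-free
ISO₃ row `u^{c₃} ≤ M^{b₃}·ρ₀·π·π′` gives `u ≤ (P²·M^{b₃})^{1/c₃}`. -/
theorem hubTriple_root {u m r p q P c : ℝ} (hu : 0 ≤ u) (hc : 0 < c) (hm : 0 ≤ m) (hr : 0 ≤ r) (hr1 : r ≤ 1)
    (hp : 0 ≤ p) (hpP : p ≤ P) (hq : 0 ≤ q) (hqP : q ≤ P) (iso : u ^ c ≤ m * r * p * q) :
    u ≤ (P ^ 2 * m) ^ c⁻¹ :=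
  RpowCert.le_rpow_inv hu hc (iso.trans (prod_bound hm hr hr1 hp hpP hq hqP))

/-- **THEOREM BOTTOM, regimes A and B2 (CLEAN-CERTIFICATES §8; PROPOSITION W₄ is the case `T_max ≤ K`).**
Let `x ≥ 0` be a law with the budgets `B₂, B₃, B₄`, the scale-free normalisation `x(v₁ cut) ≤ 1`, and the six
hub-triple isolation rows ISO₃ in scale-free form `u_{0ab}^{c₃} ≤ M^{3−c₃}·ρ₀^{0ab}·π_{a¬b}·π_{b¬a}`
(`c₃ = (3+√3)/2`, `M > 0`).  If every layer satisfies `T_z ≤ 2K` (`K = x(KK)`; i.e. `K ≥ ½T_max`: regimes A and B2),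
then `E ≤ 2·(6^{c₃}·25)^{1/(c₃−2)}·M^{√3}` (`= 1.41·10⁹·M^{√3}`; the supports are `≤ 5K`, the bootstrap exponent is
`c₃/(c₃−2) = 3 + 2√3`). -/
theorem bottom_regime_AB2 (x : DType → ℝ) (hx : ∀ τ, 0 ≤ x τ) {M : ℝ} (hM : 0 < M)
    (hB2 : lin (fun τ => τ.bud 2) x ≤ 0) (hB3 : lin (fun τ => τ.bud 3) x ≤ 0)
    (hB4 : lin (fun τ => τ.bud 4) x ≤ 0) (hnorm : lin (fun τ => τ.cutZ 1) x ≤ 1)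
    (iso : ∀ a ∈ [1, 2, 3, 4], ∀ b ∈ [1, 2, 3, 4], a < b →
      uS [0, a, b] x ^ ((3 + Real.sqrt 3) / 2) ≤
        M ^ (3 - (3 + Real.sqrt 3) / 2) * Rho0 a b x * Pim a b x * Pim b a x)
    (hreg : ∀ z ∈ [1, 2, 3, 4], Tm z x ≤ 2 * Km x) :
    E x ≤ 2 * ((6 : ℝ) ^ ((3 + Real.sqrt 3) / 2) * 25) ^ ((3 + Real.sqrt 3) / 2 - 2)⁻¹ * M ^ Real.sqrt 3 := by
  have h1lt : (1:ℝ) < Real.sqrt 3 := by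
    rw [show (1:ℝ) = Real.sqrt 1 by simp]; exact Real.sqrt_lt_sqrt (by norm_num) (by norm_num)
  have hc2 : (2:ℝ) < ((3 + Real.sqrt 3) / 2) := by linarith
  have hc0 : (0:ℝ) < ((3 + Real.sqrt 3) / 2) := by linarith
  have hRHS : 0 ≤ 2 * ((6 : ℝ) ^ ((3 + Real.sqrt 3) / 2) * 25) ^ (((3 + Real.sqrt 3) / 2) - 2)⁻¹ * M ^ Real.sqrt 3 := by positivity
  by_cases hE : E x ≤ 0
  · exact hE.trans hRHS
  push Not at hE
  have hK0 : 0 ≤ Km x := lin_ind_nonneg _ hx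
  -- supports ≤ 5K
  have hpi : ∀ z ∈ [1, 2, 3, 4], ∀ y ∈ [1, 2, 3, 4], z ≠ y → Pim z y x ≤ 5 * Km x := by
    intro z hz y hy hzy
    have h := piSupp_le x hx hB2 hB3 hB4 z hz y hy hzy
    have hTz := hreg z hz; have hTy := hreg y hy
    linarith
  -- each hub triple ≤ (25 K² M^{b₃})^{1/((3 + Real.sqrt 3) / 2)}
  have hm : 0 ≤ M ^ (3 - ((3 + Real.sqrt 3) / 2)) := Real.rpow_nonneg hM.le _
  have hu : ∀ a ∈ [1, 2, 3, 4], ∀ b ∈ [1, 2, 3, 4], a < b →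
      uS [0, a, b] x ≤ ((5 * Km x) ^ 2 * M ^ (3 - ((3 + Real.sqrt 3) / 2))) ^ ((3 + Real.sqrt 3) / 2)⁻¹ := by
    intro a ha b hb hab
    have hne : a ≠ b := ne_of_lt hab
    exact hubTriple_root (lin_ind_nonneg _ hx) hc0 hm (lin_ind_nonneg _ hx)
      (rho0_le_one x hx hnorm hB2 hB3 hB4 a ha b hb hne) (lin_ind_nonneg _ hx) (hpi a ha b hb hne)
      (lin_ind_nonneg _ hx) (hpi b hb a ha hne.symm) (iso a ha b hb hab)
  have hK : Km x ≤ 6 * ((25 * M ^ (3 - ((3 + Real.sqrt 3) / 2))) * Km x ^ 2) ^ ((3 + Real.sqrt 3) / 2)⁻¹ := by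
    have hs := K_le_hubTriples x hx
    have e : (5 * Km x) ^ 2 * M ^ (3 - ((3 + Real.sqrt 3) / 2)) = (25 * M ^ (3 - ((3 + Real.sqrt 3) / 2))) * Km x ^ 2 := by ring
    have h12 := hu 1 (by simp) 2 (by simp) (by norm_num); have h13 := hu 1 (by simp) 3 (by simp) (by norm_num)
    have h14 := hu 1 (by simp) 4 (by simp) (by norm_num); have h23 := hu 2 (by simp) 3 (by simp) (by norm_num)
    have h24 := hu 2 (by simp) 4 (by simp) (by norm_num); have h34 := hu 3 (by simp) 4 (by simp) (by norm_num)
    rw [e] at h12 h13 h14 h23 h24 h34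
    linarith
  have hA : 0 < 25 * M ^ (3 - ((3 + Real.sqrt 3) / 2)) := by positivity
  have hboot := iso3_bootstrap hK0 hA hc2 (by norm_num : (0:ℝ) < 6) hK
  -- rewrite the bound as C · M^{√3}
  have hsplit : ((6 : ℝ) ^ ((3 + Real.sqrt 3) / 2) * (25 * M ^ (3 - ((3 + Real.sqrt 3) / 2)))) ^ (((3 + Real.sqrt 3) / 2) - 2)⁻¹ =
      ((6 : ℝ) ^ ((3 + Real.sqrt 3) / 2) * 25) ^ (((3 + Real.sqrt 3) / 2) - 2)⁻¹ * M ^ Real.sqrt 3 := by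
    rw [show (6 : ℝ) ^ ((3 + Real.sqrt 3) / 2) * (25 * M ^ (3 - ((3 + Real.sqrt 3) / 2))) = ((6 : ℝ) ^ ((3 + Real.sqrt 3) / 2) * 25) * M ^ (3 - ((3 + Real.sqrt 3) / 2)) by ring,
      Real.mul_rpow (by positivity) hm, rpow_b3_root M hM.le]
  have hT1 := E_le_T_all x hx hB2 hB3 hB4 1 (by simp)
  have hK2 := hreg 1 (by simp)
  rw [hsplit] at hboot
  linarith

/-- **PROPOSITION W₄ (regime A alone; CLEAN-CERTIFICATES §5).**  Under the hypotheses of `bottom_regime_AB2`, if the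
junk-type mass dominates every layer, `T_z ≤ K` for all `z` (`K = x(KK)`), then the supports are `≤ 3K` and
`E ≤ K ≤ (6^{c₃}·9)^{1/(c₃−2)}·M^{√3}` (`= 4.34·10⁷·M^{√3}`, the pure ISO₃ bootstrap). -/
theorem propW4 (x : DType → ℝ) (hx : ∀ τ, 0 ≤ x τ) {M : ℝ} (hM : 0 < M)
    (hB2 : lin (fun τ => τ.bud 2) x ≤ 0) (hB3 : lin (fun τ => τ.bud 3) x ≤ 0)
    (hB4 : lin (fun τ => τ.bud 4) x ≤ 0) (hnorm : lin (fun τ => τ.cutZ 1) x ≤ 1)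
    (iso : ∀ a ∈ [1, 2, 3, 4], ∀ b ∈ [1, 2, 3, 4], a < b →
      uS [0, a, b] x ^ ((3 + Real.sqrt 3) / 2) ≤ M ^ (3 - ((3 + Real.sqrt 3) / 2)) * Rho0 a b x * Pim a b x * Pim b a x)
    (hreg : ∀ z ∈ [1, 2, 3, 4], Tm z x ≤ Km x) :
    E x ≤ Km x ∧ (0 < E x → Km x ≤ ((6 : ℝ) ^ ((3 + Real.sqrt 3) / 2) * 9) ^ (((3 + Real.sqrt 3) / 2) - 2)⁻¹ * M ^ Real.sqrt 3) := by
  have h1lt : (1:ℝ) < Real.sqrt 3 := by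
    rw [show (1:ℝ) = Real.sqrt 1 by simp]; exact Real.sqrt_lt_sqrt (by norm_num) (by norm_num)
  have hc2 : (2:ℝ) < ((3 + Real.sqrt 3) / 2) := by linarith
  have hc0 : (0:ℝ) < ((3 + Real.sqrt 3) / 2) := by linarith
  have hT1 := E_le_T_all x hx hB2 hB3 hB4 1 (by simp)
  refine ⟨hT1.trans (hreg 1 (by simp)), fun hE => ?_⟩
  have hK0 : 0 ≤ Km x := lin_ind_nonneg _ hx
  have hpi : ∀ z ∈ [1, 2, 3, 4], ∀ y ∈ [1, 2, 3, 4], z ≠ y → Pim z y x ≤ 3 * Km x := by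
    intro z hz y hy hzy
    have h := piSupp_le x hx hB2 hB3 hB4 z hz y hy hzy
    have hTz := hreg z hz; have hTy := hreg y hy
    linarith
  have hm : 0 ≤ M ^ (3 - ((3 + Real.sqrt 3) / 2)) := Real.rpow_nonneg hM.le _
  have hu : ∀ a ∈ [1, 2, 3, 4], ∀ b ∈ [1, 2, 3, 4], a < b →
      uS [0, a, b] x ≤ ((3 * Km x) ^ 2 * M ^ (3 - ((3 + Real.sqrt 3) / 2))) ^ ((3 + Real.sqrt 3) / 2)⁻¹ := by
    intro a ha b hb hab
    have hne : a ≠ b := ne_of_lt hab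
    exact hubTriple_root (lin_ind_nonneg _ hx) hc0 hm (lin_ind_nonneg _ hx)
      (rho0_le_one x hx hnorm hB2 hB3 hB4 a ha b hb hne) (lin_ind_nonneg _ hx) (hpi a ha b hb hne)
      (lin_ind_nonneg _ hx) (hpi b hb a ha hne.symm) (iso a ha b hb hab)
  have hK : Km x ≤ 6 * ((9 * M ^ (3 - ((3 + Real.sqrt 3) / 2))) * Km x ^ 2) ^ ((3 + Real.sqrt 3) / 2)⁻¹ := by
    have hs := K_le_hubTriples x hx
    have e : (3 * Km x) ^ 2 * M ^ (3 - ((3 + Real.sqrt 3) / 2)) = (9 * M ^ (3 - ((3 + Real.sqrt 3) / 2))) * Km x ^ 2 := by ring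
    have h12 := hu 1 (by simp) 2 (by simp) (by norm_num); have h13 := hu 1 (by simp) 3 (by simp) (by norm_num)
    have h14 := hu 1 (by simp) 4 (by simp) (by norm_num); have h23 := hu 2 (by simp) 3 (by simp) (by norm_num)
    have h24 := hu 2 (by simp) 4 (by simp) (by norm_num); have h34 := hu 3 (by simp) 4 (by simp) (by norm_num)
    rw [e] at h12 h13 h14 h23 h24 h34
    linarith
  have hA : 0 < 9 * M ^ (3 - ((3 + Real.sqrt 3) / 2)) := by positivity
  have hboot := iso3_bootstrap hK0 hA hc2 (by norm_num : (0:ℝ) < 6) hK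
  have hsplit : ((6 : ℝ) ^ ((3 + Real.sqrt 3) / 2) * (9 * M ^ (3 - ((3 + Real.sqrt 3) / 2)))) ^ (((3 + Real.sqrt 3) / 2) - 2)⁻¹ =
      ((6 : ℝ) ^ ((3 + Real.sqrt 3) / 2) * 9) ^ (((3 + Real.sqrt 3) / 2) - 2)⁻¹ * M ^ Real.sqrt 3 := by
    rw [show (6 : ℝ) ^ ((3 + Real.sqrt 3) / 2) * (9 * M ^ (3 - ((3 + Real.sqrt 3) / 2))) = ((6 : ℝ) ^ ((3 + Real.sqrt 3) / 2) * 9) * M ^ (3 - ((3 + Real.sqrt 3) / 2)) by ring,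
      Real.mul_rpow (by positivity) hm, rpow_b3_root M hM.le]
  rw [hsplit] at hboot
  exact hboot

/-! ### Regime B1 of THEOREM BOTTOM (the dominant relay is not junk-dominated: `K ≤ ½T_w`) — real-analysis helpers -/

/-- A triple row with supports `r ≤ R`, `p, q ≤ P`: `u^c ≤ m·r·p·q` ⟹ `u ≤ (R·P²·m)^{1/c}`. -/
theorem triple_root {u m r p q R P c : ℝ} (hu : 0 ≤ u) (hc : 0 < c) (hm : 0 ≤ m) (hr : 0 ≤ r) (hrR : r ≤ R)
    (hp : 0 ≤ p) (hpP : p ≤ P) (hq : 0 ≤ q) (hqP : q ≤ P) (iso : u ^ c ≤ m * r * p * q) :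
    u ≤ (R * P ^ 2 * m) ^ c⁻¹ :=
  RpowCert.le_rpow_inv hu hc (iso.trans (prod_bound' hm hr hrR hp hpP hq hqP))

/-- `(4·X)^{1/c} = 4^{1/c}·X^{1/c}` and monotonicity: the relay-triple cap in terms of the hub-triple cap. -/
theorem root_four_mul {X c : ℝ} (hX : 0 ≤ X) : (4 * X) ^ c⁻¹ = (4 : ℝ) ^ c⁻¹ * X ^ c⁻¹ :=
  Real.mul_rpow (by norm_num) hX

/-- **The ISO₄/STAR step solved (pure real arithmetic).**  `0 < t ≤ T`, `2 < c < 3` and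
`(T·t)^c ≤ A·T·t³` imply `T ≤ A^{1/(2c−4)}`. -/
theorem iso4_solve {T t c A : ℝ} (ht : 0 < t) (htT : t ≤ T) (hc2 : 2 < c) (hc3 : c < 3)
    (h : (T * t) ^ c ≤ A * T * t ^ 3) : T ≤ A ^ (2 * c - 4)⁻¹ := by
  have hT : 0 < T := lt_of_lt_of_le ht htT
  -- (T t)^c = T^(c-1) t^(c-3) · (T t³)
  have e1 : (T * t) ^ c = (T ^ (c - 1) * t ^ (c - 3)) * (T * t ^ 3) := by
    rw [Real.mul_rpow hT.le ht.le]
    have eT : T ^ c = T ^ (c - 1) * T := by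
      conv_lhs => rw [show c = (c - 1) + 1 by ring, Real.rpow_add hT, Real.rpow_one]
    have et : t ^ c = t ^ (c - 3) * t ^ 3 := by
      conv_lhs => rw [show c = (c - 3) + 3 by ring, Real.rpow_add ht]
      rw [show (3:ℝ) = ((3:ℕ):ℝ) by norm_num, Real.rpow_natCast]
    rw [eT, et]; ring
  have hTt3 : 0 < T * t ^ 3 := by positivity
  have h2 : T ^ (c - 1) * t ^ (c - 3) ≤ A := by
    rw [e1, show A * T * t ^ 3 = A * (T * t ^ 3) by ring] at h
    exact le_of_mul_le_mul_right h hTt3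
  -- t ≤ T and c - 3 < 0: T^(c-3) ≤ t^(c-3)
  have h3 : T ^ (c - 3) ≤ t ^ (c - 3) := Real.rpow_le_rpow_of_nonpos ht htT (by linarith)
  have h4 : T ^ (2 * c - 4) ≤ A := by
    have e2 : T ^ (2 * c - 4) = T ^ (c - 1) * T ^ (c - 3) := by
      rw [← Real.rpow_add hT]; ring_nf
    rw [e2]
    exact (mul_le_mul_of_nonneg_left h3 (Real.rpow_nonneg hT.le _)).trans h2
  have hc' : 0 < 2 * c - 4 := by linarith
  calc T = (T ^ (2 * c - 4)) ^ (2 * c - 4)⁻¹ := (Real.rpow_rpow_inv hT.le (ne_of_gt hc')).symm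
    _ ≤ A ^ (2 * c - 4)⁻¹ := Real.rpow_le_rpow (Real.rpow_nonneg hT.le _) h4 (inv_nonneg.mpr hc'.le)

/-- Monotonicity of a product of four nonnegative factors (the ISO₄ profile bound). -/
theorem prod4_mono {X p1 q1 p2 q2 p3 q3 p4 q4 : ℝ} (hX : 0 ≤ X) (h1 : 0 ≤ p1) (h1' : p1 ≤ q1) (h2 : 0 ≤ p2)
    (h2' : p2 ≤ q2) (h3 : 0 ≤ p3) (h3' : p3 ≤ q3) (h4 : 0 ≤ p4) (h4' : p4 ≤ q4) :
    X * p1 * p2 * p3 * p4 ≤ X * q1 * q2 * q3 * q4 := by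
  have hq1 : 0 ≤ q1 := h1.trans h1'
  have hq2 : 0 ≤ q2 := h2.trans h2'
  have hq3 : 0 ≤ q3 := h3.trans h3'
  have e1 : X * p1 ≤ X * q1 := mul_le_mul_of_nonneg_left h1' hX
  have e2 : X * p1 * p2 ≤ X * q1 * q2 := mul_le_mul e1 h2' h2 (mul_nonneg hX hq1)
  have e3 : X * p1 * p2 * p3 ≤ X * q1 * q2 * q3 := mul_le_mul e2 h3' h3 (mul_nonneg (mul_nonneg hX hq1) hq2)
  exact mul_le_mul e3 h4' h4 (mul_nonneg (mul_nonneg (mul_nonneg hX hq1) hq2) hq3)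

/-- Membership lift: an element of a three-element list of relays is a relay. -/
theorem mem_relays_of_mem3 {a p q r : ℕ} (hp : p ∈ [1, 2, 3, 4]) (hq : q ∈ [1, 2, 3, 4]) (hr : r ∈ [1, 2, 3, 4])
    (ha : a ∈ [p, q, r]) : a ∈ [1, 2, 3, 4] := by
  simp only [List.mem_cons, List.not_mem_nil, or_false] at ha
  rcases ha with rfl | rfl | rfl <;> assumption

/-- The four-point exponent: `2 < c₄ = (3+√(11/3))/2 < 3`. -/
theorem c4_bounds : 2 < (3 + Real.sqrt (11 / 3)) / 2 ∧ (3 + Real.sqrt (11 / 3)) / 2 < 3 := by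
  have h1 : 1 < Real.sqrt (11 / 3) := by
    rw [show (1:ℝ) = Real.sqrt 1 by simp]; exact Real.sqrt_lt_sqrt (by norm_num) (by norm_num)
  have h2 : Real.sqrt (11 / 3) < 3 := by
    rw [show (3:ℝ) = Real.sqrt (3 ^ 2) by rw [Real.sqrt_sq]; norm_num]
    exact Real.sqrt_lt_sqrt (by norm_num) (by norm_num)
  constructor <;> linarith

/-- Each `x(v_z cut) ≤ 1` in scale-free units under the budgets, hence `Σ_z x(v_z cut) ≤ 4`. -/
theorem cut_le_one (x : DType → ℝ) (hx : ∀ τ, 0 ≤ x τ) (hnorm : lin (fun τ => τ.cutZ 1) x ≤ 1)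
    (hB2 : lin (fun τ => τ.bud 2) x ≤ 0) (hB3 : lin (fun τ => τ.bud 3) x ≤ 0)
    (hB4 : lin (fun τ => τ.bud 4) x ≤ 0) : ∀ a ∈ [1, 2, 3, 4], lin (fun τ => τ.cutZ a) x ≤ 1 := by
  intro a ha
  have h3 := cc_bound _ x (fun τ hτ => (budget_combo τ hτ a ha (if a = 1 then 2 else 1) (by
    simp only [List.mem_cons]; split <;> simp) (by split <;> omega)).2.2) hx
  simp only [List.map_cons, List.map_nil, List.sum_cons, List.sum_nil] at h3
  push_cast at h3
  have hBa : lin (fun τ => τ.bud a) x ≤ 0 := by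
    simp only [List.mem_cons, List.not_mem_nil, or_false] at ha
    rcases ha with rfl | rfl | rfl | rfl
    · rw [lin_bud_one]
    · exact hB2
    · exact hB3
    · exact hB4
  linarith


end

end TypeTable
end HubOnly

end Summit.CriticalPhenomena.PercolationContinuityZ3.Theorems
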